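import Literature.AlgebraicTopology.SingularHomology.RelFundamentalClassModTwo
import Literature.AlgebraicTopology.SingularHomology.WuClassesBoundary
import Literature.AlgebraicTopology.SingularHomology.WuEulerCharacteristic
import Literature.AlgebraicTopology.SingularHomology.ModPBettiNumbers
import Literature.AlgebraicTopology.SingularHomology.BoundaryPiecesDuality
import Literature.AlgebraicTopology.SingularHomology.EulerCharacteristicTriple
import Literature.AlgebraicTopology.SingularHomology.UniversalCoefficientsField
import HarnessLib

/-!
# Programme TOP, brick A (pure topology): mod-2 isotropy of a boundary piece; `χ = 2` for a
# closed surface with `b₁(𝔽₂) = 0`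

Crux `HawkingExtensionIsKerr` (stmt-FinalStateConjecture-17840), line `SketchIdeator2`, stub
`stub_top_topology`.  Two closed statements of singular (co)homology, no geometry:

1. **Isotropy.**  `W : Type` compact Hausdorff, charted on `EuclideanHalfSpace 3` (a compact `C⁰`
   3-manifold with boundary `∂W = (𝓡∂ 3).boundary W`), `B₀ ⊆ ∂W` clopen, and every class of
   `H₁(B₀; 𝔽₂)` dies in `H₁(W; 𝔽₂)`.  Then `H₁(B₀; 𝔽₂) = 0`.
   Proof (A. Hatcher, *Algebraic Topology* (2002), §3.3, proof of Thm. 3.43, p. 254, "half lives,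
   half dies", in its mod-2 isotropy form): with `z = [W, ∂W]₂` (`relFundamentalClassModTwo`) and
   `[∂W]₂ = ∂z` (`modTwoFundamentalClass_boundary_eq_δ`), Lefschetz duality mod 2
   (`bijective_relCapProduct_relFundamentalClassModTwo`) and the duality ladder
   (`map_range_cohomologyMap_eq_range_δ`) give `(im i^*) ⌢ [∂W]₂ = im ∂ = ker i_*`
   (`relativeSingularHomology.exact_δ_map`).  Split `∂W ≅ B₀ ⊔ B₀ᶜ`
   (`exists_sumHomeomorph_of_isClosed_cover`), `[∂W]₂ = f_* c₀ + g_* c₁`; capping with `c₀` is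
   bijective on `B₀` (`bijective_capProduct_piece`, Poincaré duality of `∂W` being block
   diagonal).  A class `a ∈ H¹(B₀)` extends by zero to `b ∈ H¹(∂W)` (`exists_cohomology_extension`)
   with `b ⌢ [∂W]₂ = f_*(a ⌢ c₀)`, which dies in `W` by hypothesis, so `b ⌢ [∂W]₂ ∈ ker i_*` and
   `b ∈ im i^*` (Poincaré duality of `∂W` is injective).  For two such classes
   `⟨a', a ⌢ c₀⟩ = ⟨b', b ⌢ [∂W]₂⟩ = ⟨b' ⌣ b, [∂W]₂⟩ = 0` since `im i^*` is a subring pairing to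
   zero with `[∂W]₂ = ∂z` (`cupProduct_mem_range_map`,
   `kroneckerPairing_modTwoFundamentalClass_boundary_eq_zero`); linear forms separate points over
   the field `𝔽₂`, so `a ⌢ c₀ = 0`, `a = 0`, `H¹(B₀; 𝔽₂) = 0` and dually `H₁(B₀; 𝔽₂) = 0`.
2. **Surfaces.**  `S : Type` compact connected Hausdorff, charted on `ℝ²`, with `H₁(S; 𝔽₂) = 0`:
   the integral homology is finitely generated and vanishes from degree `3` on
   (`finite_singularHomology_of_compactSpace_holds`, `isZero_singularHomology_of_lt_holds`), and
   `χ(S) = relEuler ℤ ℤ S ∅ = 2`: `χ_ℤ = χ_{𝔽₂}` (`eulerChar_int_eq_eulerChar_zmod`),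
   `b₀ = 1` (path connected), `b₁ = 0`, `b₂ = b₀` (mod-2 Poincaré duality,
   `finrank_singularHomology_zmod_two_eq_of_add_eq`).

## References

* A. Hatcher, *Algebraic Topology*, CUP 2002, §3.3 Thm. 3.43 (proof, p. 254), Cor. 3.37,
  Prop. 2.7, §3.A Exercise 1. [HatcherAT2002]
-/

noncomputable section

set_option linter.dupNamespace false

namespace Summit.FinalStateConjecture.FinalStateConjecture.Theorems.HawkingExtensionIsKerr.SketchIdeator2

open Set Filter Function CategoryTheory Limits Literature.AlgebraicTopology.SingularHomology
open scoped Manifold ContDiff Topology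

/-! ## Part 1: mod-2 isotropy of a clopen boundary piece whose 1-classes die in `W` -/

/-- **Mod-2 isotropy of a boundary piece.**  For a compact Hausdorff `W : Type` charted on
`EuclideanHalfSpace 3` and a clopen `B₀ ⊆ ∂W` such that `H₁(B₀; 𝔽₂) → H₁(W; 𝔽₂)` vanishes,
`H₁(B₀; 𝔽₂) = 0` (Hatcher 2002, proof of Thm. 3.43, p. 254: the image of `H¹(W)` in `H¹(∂W)` is
cup-isotropic and Poincaré dual to `ker (H₁(∂W) → H₁(W))`; the classes supported on `B₀` lie in
it, and the cup pairing of `∂W` restricted to them is the nondegenerate pairing of `B₀`).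
[cite: HatcherAT2002, §3.3 Thm. 3.43 (proof, p. 254)] -/
theorem isZero_singularHomology_one_boundaryPiece (W : Type) [TopologicalSpace W] [T2Space W]
    [CompactSpace W] [ChartedSpace (EuclideanHalfSpace 3) W] (B₀ : Set ↥((𝓡∂ 3).boundary W))
    (hB₀ : IsClopen B₀)
    (H : singularHomology.map (ZMod 2) (ZMod 2)
      (⟨fun x : ↥B₀ ↦ ((x : ↥((𝓡∂ 3).boundary W)) : W), by fun_prop⟩ : C(↥B₀, W)) 1 = 0) :
    IsZero (singularHomology (ZMod 2) (ZMod 2) ↥B₀ 1) := by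
  haveI : Fact (Nat.Prime 2) := ⟨Nat.prime_two⟩
  letI := boundaryTopChartedSpace (n := 2) (W := W)
  haveI : CompactSpace ↥((𝓡∂ 3).boundary W) := compactSpace_boundary (n := 2)
  haveI : CompactSpace ↥B₀ := isCompact_iff_compactSpace.mp hB₀.isClosed.isCompact
  haveI : CompactSpace ↥(B₀ᶜ) := isCompact_iff_compactSpace.mp hB₀.compl.isClosed.isCompact
  -- the splitting `∂W ≅ B₀ ⊔ B₀ᶜ`
  obtain ⟨e, hef, heg⟩ := exists_sumHomeomorph_of_isClosed_cover (subsetIncl B₀) (subsetIncl B₀ᶜ)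
    Subtype.val_injective Subtype.val_injective
    (by
      refine Set.disjoint_left.mpr ?_
      rintro p ⟨b, rfl⟩ ⟨a, ha⟩
      exact a.2 (by rw [show (a : ↥((𝓡∂ 3).boundary W)) = b from ha]; exact b.2))
    (by
      refine Set.eq_univ_of_forall fun p => ?_
      by_cases hp : p ∈ B₀
      · exact Or.inl ⟨⟨p, hp⟩, rfl⟩
      · exact Or.inr ⟨⟨p, hp⟩, rfl⟩)
  have hsplit := fun j => exists_eq_map_add_map (R := ZMod 2) (M := ZMod 2) (subsetIncl B₀)
    (subsetIncl B₀ᶜ) e hef heg j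
  have hinj := fun {j : ℕ} (c₁ : singularHomology (ZMod 2) (ZMod 2) (↥B₀) j)
      (c₂ : singularHomology (ZMod 2) (ZMod 2) (↥(B₀ᶜ)) j)
      (h : singularHomology.map (ZMod 2) (ZMod 2) (subsetIncl B₀) j c₁ +
        singularHomology.map (ZMod 2) (ZMod 2) (subsetIncl B₀ᶜ) j c₂ = 0) =>
    eq_zero_of_map_add_map_eq_zero (R := ZMod 2) (M := ZMod 2) (subsetIncl B₀) (subsetIncl B₀ᶜ)
      e hef heg h
  have hext := fun j => exists_cohomology_extension (R := ZMod 2) (M := ZMod 2) (subsetIncl B₀)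
    (subsetIncl B₀ᶜ) e hef heg j
  -- the fundamental classes `z = [W, ∂W]₂`, `μ = [∂W]₂ = ∂z`
  have h11 : 1 + 1 = 2 := rfl
  have hμ : modTwoFundamentalClass ↥((𝓡∂ 3).boundary W) 2 =
      relativeSingularHomology.δ (ZMod 2) (ZMod 2) W ((𝓡∂ 3).boundary W) 2
        (relFundamentalClassModTwo 2 W) :=
    modTwoFundamentalClass_boundary_eq_δ (n := 2) (W := W) two_ne_zero
  -- Poincaré duality mod 2 on `∂W`
  have hD : Function.Bijective fun b : singularCohomology (ZMod 2) (ZMod 2) ↥((𝓡∂ 3).boundary W) 1 =>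
      capProduct (M := ZMod 2) h11 b (modTwoFundamentalClass ↥((𝓡∂ 3).boundary W) 2) := by
    have hfun : (fun b : singularCohomology (ZMod 2) (ZMod 2) ↥((𝓡∂ 3).boundary W) 1 =>
        capProduct (M := ZMod 2) h11 b (modTwoFundamentalClass ↥((𝓡∂ 3).boundary W) 2)) =
        ⇑(poincareDualityMap (modTwoOrientation ↥((𝓡∂ 3).boundary W) 2) h11) :=
      funext fun b => (poincareDualityMap_apply _ h11 b).symm
    rw [hfun]
    exact poincare_duality (modTwoOrientation ↥((𝓡∂ 3).boundary W) 2) h11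
  -- the pieces of `[∂W]₂` and duality on the piece `B₀`
  obtain ⟨c₀, c₁, hc⟩ := hsplit 2 (modTwoFundamentalClass ↥((𝓡∂ 3).boundary W) 2)
  have hD₀ : Function.Bijective fun a : singularCohomology (ZMod 2) (ZMod 2) ↥B₀ 1 =>
      capProduct (M := ZMod 2) h11 a c₀ := by
    refine bijective_capProduct_piece (subsetIncl B₀) (subsetIncl B₀ᶜ) h11
      (fun c₁ c₂ hc0 => hinj c₁ c₂ hc0) (hext 1) c₀ c₁ ?_
    rw [← hc]
    exact hD
  -- Lefschetz duality mod 2 and the ladder: `(im i^*) ⌢ [∂W]₂ = im ∂ = ker i_*`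
  have hL : Function.Surjective fun a : singularCohomology (ZMod 2) (ZMod 2) W 1 =>
      relCapProduct (M := ZMod 2) ((𝓡∂ 3).boundary W) (show 1 + (1 + 1) = 2 + 1 by rfl) a
        (relFundamentalClassModTwo 2 W) :=
    (bijective_relCapProduct_relFundamentalClassModTwo (n := 2) (W := W) _).2
  have e1 := map_range_cohomologyMap_eq_range_δ (M := ZMod 2) (relFundamentalClassModTwo 2 W) h11 hL
  have e2 : LinearMap.range (relativeSingularHomology.δ (ZMod 2) (ZMod 2) W ((𝓡∂ 3).boundary W) 1).hom =
      LinearMap.ker (singularHomology.map (ZMod 2) (ZMod 2) (subsetIncl ((𝓡∂ 3).boundary W)) 1).hom :=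
    (relativeSingularHomology.exact_δ_map (ZMod 2) (ZMod 2) ((𝓡∂ 3).boundary W) 1).moduleCat_range_eq_ker
  -- the duality map of `∂W` on an extension by zero `b` of `a ∈ H¹(B₀)`
  have hDb : ∀ (a : singularCohomology (ZMod 2) (ZMod 2) ↥B₀ 1)
      (b : singularCohomology (ZMod 2) (ZMod 2) ↥((𝓡∂ 3).boundary W) 1),
      singularCohomology.map (ZMod 2) (ZMod 2) (subsetIncl B₀) 1 b = a →
      singularCohomology.map (ZMod 2) (ZMod 2) (subsetIncl B₀ᶜ) 1 b = 0 →
      capProduct (M := ZMod 2) h11 b (modTwoFundamentalClass ↥((𝓡∂ 3).boundary W) 2) =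
        singularHomology.map (ZMod 2) (ZMod 2) (subsetIncl B₀) 1 (capProduct (M := ZMod 2) h11 a c₀) := by
    intro a b hfb hgb
    rw [hc, map_add, ← capProduct_map, ← capProduct_map, hfb, hgb, map_zero, LinearMap.zero_apply,
      map_zero, add_zero]
  -- such a `b` comes from `W`
  have key : ∀ (a : singularCohomology (ZMod 2) (ZMod 2) ↥B₀ 1)
      (b : singularCohomology (ZMod 2) (ZMod 2) ↥((𝓡∂ 3).boundary W) 1),
      singularCohomology.map (ZMod 2) (ZMod 2) (subsetIncl B₀) 1 b = a →
      singularCohomology.map (ZMod 2) (ZMod 2) (subsetIncl B₀ᶜ) 1 b = 0 →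
      b ∈ LinearMap.range (singularCohomology.map (ZMod 2) (ZMod 2)
        (subsetIncl ((𝓡∂ 3).boundary W)) 1).hom := by
    intro a b hfb hgb
    have hker : capProduct (M := ZMod 2) h11 b (modTwoFundamentalClass ↥((𝓡∂ 3).boundary W) 2) ∈
        LinearMap.ker (singularHomology.map (ZMod 2) (ZMod 2) (subsetIncl ((𝓡∂ 3).boundary W)) 1).hom := by
      rw [LinearMap.mem_ker, hDb a b hfb hgb]
      change (singularHomology.map (ZMod 2) (ZMod 2) (subsetIncl B₀) 1 ≫
        singularHomology.map (ZMod 2) (ZMod 2) (subsetIncl ((𝓡∂ 3).boundary W)) 1) _ = 0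
      rw [← singularHomology.map_comp]
      exact congrFun (congrArg DFunLike.coe (congrArg ModuleCat.Hom.hom H)) _
    rw [← e2, ← e1] at hker
    obtain ⟨b', hb', hbb'⟩ := hker
    rw [LinearMap.flip_apply, ← hμ] at hbb'
    have hb'b : b' = b := hD.1 hbb'
    exact hb'b ▸ hb'
  -- hence `H¹(B₀; 𝔽₂) = 0`
  have hH1 : ∀ a : singularCohomology (ZMod 2) (ZMod 2) ↥B₀ 1, a = 0 := by
    intro a
    obtain ⟨b, hfb, hgb⟩ := hext 1 a
    have hb := key a b hfb hgb
    apply hD₀.1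
    change capProduct (M := ZMod 2) h11 a c₀ = capProduct (M := ZMod 2) h11 0 c₀
    rw [map_zero, LinearMap.zero_apply]
    refine singularHomology.eq_zero_of_forall_kroneckerPairing_eq_zero fun a' => ?_
    obtain ⟨b', hfb', hgb'⟩ := hext 1 a'
    have hb' := key a' b' hfb' hgb'
    rw [← hfb', kroneckerPairing_map, ← hDb a b hfb hgb, ← kroneckerPairing_cupProduct]
    exact kroneckerPairing_modTwoFundamentalClass_boundary_eq_zero (n := 2) two_ne_zero
      (cupProduct_mem_range_map _ h11 hb hb')
  -- and dually `H₁(B₀; 𝔽₂) = 0`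
  haveI : Subsingleton (singularHomology (ZMod 2) (ZMod 2) ↥B₀ 1) := ⟨fun x y => by
    obtain ⟨a, rfl⟩ := hD₀.2 x
    obtain ⟨a', rfl⟩ := hD₀.2 y
    simp only [hH1 a, hH1 a']⟩
  exact ModuleCat.isZero_of_subsingleton _

/-! ## Part 2: a closed connected `C⁰` surface with `H₁(·; 𝔽₂) = 0` has `χ = 2` -/

/-- **`χ = 2` for a closed connected topological surface with `b₁(𝔽₂) = 0`.**  For `S : Type`
compact connected Hausdorff charted on `ℝ²` with `H₁(S; 𝔽₂) = 0`: the integral homology is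
finitely generated and vanishes from degree `3` on, and `relEuler ℤ ℤ S ∅ = 2` — `χ_ℤ = χ_{𝔽₂}`
(Hatcher 2002, §3.A Exercise 1), `b₀ = 1` (Prop. 2.7), `b₁ = 0`, `b₂ = b₀` (Cor. 3.37 over `𝔽₂`).
[cite: HatcherAT2002, §3.A Exercise 1 (p. 268) and §3.3 Cor. 3.37] -/
theorem finRelHomology_and_relEuler_eq_two_of_surface (S : Type) [TopologicalSpace S] [T2Space S]
    [CompactSpace S] [ConnectedSpace S] [ChartedSpace (EuclideanSpace ℝ (Fin 2)) S]
    (h1 : IsZero (singularHomology (ZMod 2) (ZMod 2) S 1)) :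
    FinRelHomology ℤ ℤ S ∅ 3 ∧ relEuler ℤ ℤ S ∅ = 2 := by
  haveI : Fact (Nat.Prime 2) := ⟨Nat.prime_two⟩
  have hF : FinRelHomology ℤ ℤ S ∅ 3 :=
    FinRelHomology.empty_of_absolute (fun k => finite_singularHomology_of_compactSpace_holds ℤ S 2 k)
      (fun _ hk => isZero_singularHomology_of_lt_holds ℤ ℤ S 2 (by omega))
  refine ⟨hF, ?_⟩
  haveI := ChartedSpace.locallyPathConnectedSpace (EuclideanSpace ℝ (Fin 2)) S
  haveI : PathConnectedSpace S := pathConnectedSpace_iff_connectedSpace.mpr inferInstance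
  have hb0 : Module.finrank (ZMod 2) (singularHomology (ZMod 2) (ZMod 2) S 0) = 1 := by
    haveI := singularHomology.isIso_ε_of_pathConnectedSpace (ZMod 2) (ZMod 2) (X := S)
    rw [(asIso (singularHomology.ε (ZMod 2) (ZMod 2) S)).toLinearEquiv.finrank_eq]
    change Module.finrank (ZMod 2) (ULift (ZMod 2)) = 1
    rw [finrank_ulift, Module.finrank_self]
  have hb1 : Module.finrank (ZMod 2) (singularHomology (ZMod 2) (ZMod 2) S 1) = 0 :=
    finrank_eq_zero_of_isZero h1
  have hb2 : Module.finrank (ZMod 2) (singularHomology (ZMod 2) (ZMod 2) S 2) = 1 := by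
    rw [finrank_singularHomology_zmod_two_eq_of_add_eq (n := 2) S (show 2 + 0 = 2 from rfl), hb0]
  have hχ : ∑ k ∈ Finset.range 3, (-1 : ℤ) ^ k * (Module.finrank ℤ (singularHomology ℤ ℤ S k) : ℤ) =
      ∑ k ∈ Finset.range 3, (-1 : ℤ) ^ k *
        (Module.finrank (ZMod 2) (singularHomology (ZMod 2) (ZMod 2) S k) : ℤ) :=
    eulerChar_int_eq_eulerChar_zmod (p := 2) 2 S
  rw [hF.relEuler_empty_eq_sum, hχ]
  simp only [Finset.sum_range_succ, Finset.sum_range_zero, hb0, hb1, hb2]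
  norm_num

/-! ## The registered stub -/

/-- **TOP-A (pure topology).** (1) Mod-2 isotropy: for a compact `C⁰` 3-manifold with boundary `W` and a clopen `B₀ ⊆ ∂W` such that `H₁(B₀; 𝔽₂) → H₁(W; 𝔽₂)` vanishes, `H₁(B₀; 𝔽₂) = 0`.  (2) A compact connected `C⁰` surface with `H₁(·; 𝔽₂) = 0` has finite integral homology concentrated in degrees `< 3` and Euler characteristic `2`. [cite: HatcherAT2002, §3.3 Thm. 3.43 (proof, p. 254), Cor. 3.37, §3.A Exercise 1] -/
theorem stub_top_topology : (∀ (W : Type) [TopologicalSpace W] [T2Space W] [CompactSpace W] [ChartedSpace (EuclideanHalfSpace 3) W] (B₀ : Set ↥((𝓡∂ 3).boundary W)), IsClopen B₀ → singularHomology.map (ZMod 2) (ZMod 2) (⟨fun x : ↥B₀ ↦ ((x : ↥((𝓡∂ 3).boundary W)) : W), by fun_prop⟩ : C(↥B₀, W)) 1 = 0 → CategoryTheory.Limits.IsZero (singularHomology (ZMod 2) (ZMod 2) ↥B₀ 1)) ∧ (∀ (S : Type) [TopologicalSpace S] [T2Space S] [CompactSpace S] [ConnectedSpace S] [ChartedSpace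 (EuclideanSpace ℝ (Fin 2)) S], CategoryTheory.Limits.IsZero (singularHomology (ZMod 2) (ZMod 2) S 1) → FinRelHomology ℤ ℤ S ∅ 3 ∧ relEuler ℤ ℤ S ∅ = 2) :=
  ⟨fun W _ _ _ _ B₀ hB₀ H => isZero_singularHomology_one_boundaryPiece W B₀ hB₀ H,
    fun S _ _ _ _ _ h1 => finRelHomology_and_relEuler_eq_two_of_surface S h1⟩

end Summit.FinalStateConjecture.FinalStateConjecture.Theorems.HawkingExtensionIsKerr.SketchIdeator2

end
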